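import Summits.Ventures.CertifiedManyBodySolver.Theses.CovHg1201M19
import Summits.Ventures.CertifiedManyBodySolver.Downfold.BoxesHg1201ESlantCutSlotsM19
import HarnessLib

/-!
# Theorems/CovHg1201M19SlantParts.lean — route «CovHg1201M19» (Hg-1201 M19 @0, optimal doping column; born 2026-08-28T12:00Z): after «SLANT-CUT» the certificate part
# of BOTH cruxes is the upper-left TRIANGLE `{σ ∈ [−27/50, −53/100], n ∈ [43/50, 22/25], n ≥ 43/50 + 2(σ + 27/50)}` — HALF of the strip the route was born on

Supports stmt-Ventures-27756 «PatchBottomM19» (and stmt-Ventures-27755 «PatchLeftEdgeM19»). The route states both cruxes directly on the doubly-cut strip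
`σ ∈ [−27/50, −53/100] × n ∈ [43/50, 22/25]` (n-cut «n_k″ = 43/50», hubbard-cov-hg1201-box-2 g1 p629747 / p630377; t′-cut «t* = −53/100», unc-3 g5 / box-2 g1 p627977), so
this seat's state-free words UNDER THE CHORD between the corners `(−27/50, 43/50)` and `(−53/100, 22/25)` (`Downfold/BoxesHg1201ESlantCutSlotsM19.lean`:
`hg1201M19_patchBottomM19_slantSlots_kinematic`, `hg1201M19_patchLeftEdgeM19_slantSlots_kinematic`; generic chord transport `Observables/StiffnessHalfBathtubSlant.lean`,
p629801 — the two `M = 512` rows of record joined by joint convexity, zero new kernel row) reduce each item to its triangle in ONE case split: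
* `covHg1201M19_PatchBottomM19_of_triangle` / `covHg1201M19_PatchLeftEdgeM19_of_triangle`: (item restricted to `n ≥ 43/50 + 2(σ + 27/50)`) → item;
* `covHg1201M19_cruxes_of_triangles`: both at once.
HONEST FRAMING: set algebra + one-body kinematics + the torus-limit variational inequality; zero solve, no claim node, no definition; CONDITIONAL on the triangle, where the
certificates (captain hubbard-cov-hg1201-plan-1's programme) are still owed; certified stiffness-scale CEILINGS on a downfolded screening-grade box = CONTROL / CALIBRATION
+ labelled heuristic (xx1; content = below `0.98 ×` the kinematic MAJORANT, no suppression below free claimed); a ceiling never speaks to the presence of superconductivity;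
not a `T_c`, phase or pressure sentence; NO item, stub or rung leaf is closed by this file; no summit statement is proved. Seat hubbard-cov-hg1201-unc-2 g3
(`prover-hubbard-cov-hg1201-unc-2-g2-0`), cell `pub/hubbard-downfold`.
-/

noncomputable section

namespace Summit.Ventures.CertifiedManyBodySolver.Theorems

open Set Filter Topology
open Summit.Ventures.CertifiedManyBodySolver.Theses.CovHg1201M19
open Summit.Ventures.CertifiedManyBodySolver.Observables
open Summit.Ventures.CertifiedManyBodySolver.Downfold
open Summit.Ventures.CertifiedManyBodySolver
open Literature.MathematicalPhysics.QuantumLattice Literature.MathematicalPhysics.QuantumLattice.ThermodynamicLimit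
open Literature.Probability.LatticeModels
open Matrix HubbardWave0
open scoped BigOperators ComplexOrder

/-- **«PatchBottomM19» (stmt-Ventures-27756) from its TRIANGLE**: the item restricted to densities `n ≥ 43/50 + 2(σ + 27/50)` (slots `σ ∈ [−27/50, −53/100]`, sources
`s ∈ [−27/50, σ]`, `n ∈ [43/50, 22/25]`, `U = 7/2`) implies the item — under the chord the word is state-free (SLANT-CUT). CONDITIONAL on the triangle.
[cite: ScalapinoWhiteZhang1993, §II] [cite: LiebLoss1993, §8, Theorem 8.2] -/
theorem covHg1201M19_PatchBottomM19_of_triangle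
    (h : ∀ n ∈ Set.Icc (43 / 50 : ℝ) (22 / 25), ∀ σ ∈ Set.Icc (-27 / 50 : ℝ) (-53 / 100), 43 / 50 + 2 * (σ + 27 / 50) ≤ n →
      ∀ s ∈ Set.Icc (-27 / 50 : ℝ) σ,
      ∀ (ω : InfVolFermionState 2) (Ls : ℕ → ℕ) (ψ : ∀ L, Fock (Orb (FermionTorus 2 L))),
      Tendsto Ls atTop atTop →
      (∀ j, IsGroundStateInSector (hubbardTorusTT' (Ls j) 1 s (7 / 2)) (rectN n (Ls j)) 0 (ψ (Ls j))) →
      (∀ j, star (ψ (Ls j)) ⬝ᵥ ψ (Ls j) = 1) → ω.IsTorusLimitOf ψ Ls →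
      -(5084577 / 10000000 : ℝ) ≤ ((Finset.univ : Finset (DihedralGroup 4)).card : ℝ)⁻¹ * ∑ g ∈ (Finset.univ : Finset (DihedralGroup 4)),
        (ω.expect (d4ShiftSet g 0 (Literature.Probability.LatticeModels.box 2 7))
          (fermionEmbed (PolySite.d4Emb g 0 (Literature.Probability.LatticeModels.box 2 7)) (-oddMomentObsTT σ (7 / 2) 0))).re) :
    PatchBottomM19 := by
  intro n hn σ hσ s hs ω Ls ψ hLs hψ h1 hω
  rcases le_or_gt n (43 / 50 + 2 * (σ + 27 / 50)) with hle | hgt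
  · exact hg1201M19_patchBottomM19_slantSlots_kinematic n hn σ hσ hle s hs ω Ls ψ hLs hψ h1 hω
  · exact h n hn σ hσ hgt.le s hs ω Ls ψ hLs hψ h1 hω

/-- **«PatchLeftEdgeM19» (stmt-Ventures-27755) from its TRIANGLE**: the item restricted to `n ≥ 43/50 + 2(σ + 27/50)` (states at `(−27/50, U′, n)`, `U′ ∈ [7/2, 44/5]`,
`σ ∈ [−27/50, −53/100]`, `n ∈ [43/50, 22/25]`) implies the item. CONDITIONAL on the triangle. [cite: ScalapinoWhiteZhang1993, §II] [cite: LiebLoss1993, §8, Theorem 8.2] -/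
theorem covHg1201M19_PatchLeftEdgeM19_of_triangle
    (h : ∀ n ∈ Set.Icc (43 / 50 : ℝ) (22 / 25), ∀ σ ∈ Set.Icc (-27 / 50 : ℝ) (-53 / 100), 43 / 50 + 2 * (σ + 27 / 50) ≤ n →
      ∀ U' ∈ Set.Icc (7 / 2 : ℝ) (44 / 5),
      ∀ (ω : InfVolFermionState 2) (Ls : ℕ → ℕ) (ψ : ∀ L, Fock (Orb (FermionTorus 2 L))),
      Tendsto Ls atTop atTop →
      (∀ j, IsGroundStateInSector (hubbardTorusTT' (Ls j) 1 (-27 / 50) U') (rectN n (Ls j)) 0 (ψ (Ls j))) →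
      (∀ j, star (ψ (Ls j)) ⬝ᵥ ψ (Ls j) = 1) → ω.IsTorusLimitOf ψ Ls →
      -(5084577 / 10000000 : ℝ) ≤ ((Finset.univ : Finset (DihedralGroup 4)).card : ℝ)⁻¹ * ∑ g ∈ (Finset.univ : Finset (DihedralGroup 4)),
        (ω.expect (d4ShiftSet g 0 (Literature.Probability.LatticeModels.box 2 7))
          (fermionEmbed (PolySite.d4Emb g 0 (Literature.Probability.LatticeModels.box 2 7)) (-oddMomentObsTT σ U' 0))).re) :
    PatchLeftEdgeM19 := by
  intro n hn σ hσ U' hU' ω Ls ψ hLs hψ h1 hω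
  rcases le_or_gt n (43 / 50 + 2 * (σ + 27 / 50)) with hle | hgt
  · exact hg1201M19_patchLeftEdgeM19_slantSlots_kinematic n hn σ hσ hle U' hU' ω Ls ψ hLs hψ h1 hω
  · exact h n hn σ hσ hgt.le U' hU' ω Ls ψ hLs hψ h1 hω

/-- **Both cruxes of «CovHg1201M19» from their TRIANGLES at once** (`1/88` of the M19 face each). [cite: ScalapinoWhiteZhang1993, §II] -/
theorem covHg1201M19_cruxes_of_triangles
    (hB : ∀ n ∈ Set.Icc (43 / 50 : ℝ) (22 / 25), ∀ σ ∈ Set.Icc (-27 / 50 : ℝ) (-53 / 100), 43 / 50 + 2 * (σ + 27 / 50) ≤ n →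
      ∀ s ∈ Set.Icc (-27 / 50 : ℝ) σ,
      ∀ (ω : InfVolFermionState 2) (Ls : ℕ → ℕ) (ψ : ∀ L, Fock (Orb (FermionTorus 2 L))),
      Tendsto Ls atTop atTop →
      (∀ j, IsGroundStateInSector (hubbardTorusTT' (Ls j) 1 s (7 / 2)) (rectN n (Ls j)) 0 (ψ (Ls j))) →
      (∀ j, star (ψ (Ls j)) ⬝ᵥ ψ (Ls j) = 1) → ω.IsTorusLimitOf ψ Ls →
      -(5084577 / 10000000 : ℝ) ≤ ((Finset.univ : Finset (DihedralGroup 4)).card : ℝ)⁻¹ * ∑ g ∈ (Finset.univ : Finset (DihedralGroup 4)),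
        (ω.expect (d4ShiftSet g 0 (Literature.Probability.LatticeModels.box 2 7))
          (fermionEmbed (PolySite.d4Emb g 0 (Literature.Probability.LatticeModels.box 2 7)) (-oddMomentObsTT σ (7 / 2) 0))).re)
    (hL : ∀ n ∈ Set.Icc (43 / 50 : ℝ) (22 / 25), ∀ σ ∈ Set.Icc (-27 / 50 : ℝ) (-53 / 100), 43 / 50 + 2 * (σ + 27 / 50) ≤ n →
      ∀ U' ∈ Set.Icc (7 / 2 : ℝ) (44 / 5),
      ∀ (ω : InfVolFermionState 2) (Ls : ℕ → ℕ) (ψ : ∀ L, Fock (Orb (FermionTorus 2 L))),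
      Tendsto Ls atTop atTop →
      (∀ j, IsGroundStateInSector (hubbardTorusTT' (Ls j) 1 (-27 / 50) U') (rectN n (Ls j)) 0 (ψ (Ls j))) →
      (∀ j, star (ψ (Ls j)) ⬝ᵥ ψ (Ls j) = 1) → ω.IsTorusLimitOf ψ Ls →
      -(5084577 / 10000000 : ℝ) ≤ ((Finset.univ : Finset (DihedralGroup 4)).card : ℝ)⁻¹ * ∑ g ∈ (Finset.univ : Finset (DihedralGroup 4)),
        (ω.expect (d4ShiftSet g 0 (Literature.Probability.LatticeModels.box 2 7))
          (fermionEmbed (PolySite.d4Emb g 0 (Literature.Probability.LatticeModels.box 2 7)) (-oddMomentObsTT σ U' 0))).re) :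
    PatchBottomM19 ∧ PatchLeftEdgeM19 :=
  ⟨covHg1201M19_PatchBottomM19_of_triangle hB, covHg1201M19_PatchLeftEdgeM19_of_triangle hL⟩

end Summit.Ventures.CertifiedManyBodySolver.Theorems

end
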